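import Summits.ABC.IUTFork.Repair.ObstructionSS6Witness
import HarnessLib

/-!
# IUT REPAIR branch, sub-cell B5 — the ZERO-ATOM NOTE on the scaling-shells bed of record `sData₀`

Record file (D-0012) of the abc-iut cell, IUT REPAIR branch; seat abc-iut-rp-s3 (prover); sequel to `Repair/ObstructionSS6Witness` (p432775).
PROOF-ONLY; TAKES NO SIDE on [IUTchIII] Cor. 3.12 and on no author; a MODEL-DESIGN note, not mathematics of the dispute.

WHAT. abc-iut-w4-d098's layer 2b `ScalarShellsThm311Zero.sData₀` (p431451) declares the zero region `{0}` ADMISSIBLE AT EVERY LABEL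
(`Adm j vQ A := A = {0} ∨ ∃ k, A = B_k`), with the junk log-volume `sVol {0} = pVol {0} = 0` (`{0}` is not a ball). Consequences at an
HONEST packet (label `2`) of the door-(b) witness `ObstructionSS6Witness.wSetting`:
* `sVol_zero`: `logvol {0} = 0`, while `logvol B_k = −k·log p`;
* `no_constant_modulus_at_honest_packet`: NO constant `c` satisfies the Haar-modulus hypothesis `hcov`/`hHaar` of abc-iut-rp-s2's price
  theorems (`ObstructionSS2.not_thetaFinite_of_rescaling`, `ObstructionSS6.S_refutes_statement_of_haar`) for the link witness `Φ₀ = sFamDep cQ`: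
  the `Φ₀`-fixed admissible atom `{0}` forces `c = 0`, the ball `B_4 ↦ B_1` forces `c = 3·log p`;
* `not_logvolMono_wSetting`: log-volume monotonicity on admissible regions (`LogvolMono`, the `hmono` of the same theorems and a conjunct of
  `BridgeHyps`) FAILS for a trivial reason (`{0} ⊆ B_1`, `0 > −log p`) — abc-iut-rp-j2's XREAD finding F1 (08:33:57Z) on this bed, recorded.
So on THIS bed the door-(b) price is obtained through the ORBIT form (abc-iut-rp-j1's `CandJoshi3.not_statement_of_unbounded_orbit`, as in
`ObstructionSS6Witness.wSetting_price`), not through the Haar forms; the Haar forms instantiate on a bed whose extra admissible region sits at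
the junk label ONLY (abc-iut-rp-j2's `CandJoshi22`, `∅` at label `0`). Nothing here bears on print. [claim: Mochizuki2012, status: disputed]
-/

noncomputable section

open Set

namespace Summit.ABC.IUTFork.Repair.ObstructionSS31

open Thm311 Cor312 Cor312.Checks Cor312.IdentifiedNonVacuity Cor312Vol Cor312Vol.NaiveWitness Cor312Vol.UnitWitness
  Cor312Vol.PinnedWitness Literature.IUT.LogThetaLattice Summit.ABC.IUTFork.Repair.ScalarShells
  Summit.ABC.IUTFork.Repair.ScalarShellsThm311 Summit.ABC.IUTFork.Repair.ScalarShellsThm311Zero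
  Summit.ABC.IUTFork.Repair.ObstructionSS6Witness

variable (p : ℕ) [hp : Fact p.Prime]

/-- The zero region has log-volume `0` in the naive volume (it is not a ball: the junk branch of `pVol`). [folklore] -/
theorem sVol_zero (j : toyIndex.Label) (vQ : toyIndex.VQ) : sVol p ⊤ j vQ ({0} : Set ((scalingShells p).Packet j vQ)) = 0 := by
  classical
  have h : ¬ ∃ k, ({0} : Set ((scalingShells p).Packet j vQ)) = pBall p j vQ k := by
    rintro ⟨k, hk⟩
    exact pBall_ne_zero p j vQ k hk.symm
  show pVol p j vQ {0} = 0
  unfold pVol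
  exact dif_neg h

/-- **NO CONSTANT MODULUS at the honest packet of the {0}-bed.** For the link witness `Φ₀ = sFamDep cQ` of `ObstructionSS6Witness` there is no
`c` with «`A` admissible ⇒ `Φ₀ ″ A` admissible and `logvol (Φ₀ ″ A) = logvol A + c`» at the packet of label `2`: the admissible atom `{0}` is
`Φ₀`-fixed with log-volume `0` (so `c = 0`), while `Φ₀ ″ B_4 = B_1` shifts the log-volume by `3·log p ≠ 0`. Hence the `hcov`/`hHaar` premise of
abc-iut-rp-s2's Haar-form price theorems is not dischargeable on `sData₀`. [folklore] -/
theorem no_constant_modulus_at_honest_packet (vQ : toyIndex.VQ) :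
    ¬ ∃ c : ℝ, ∀ A : Set ((scalingShells p).Packet (Setting.labelSucc ⟨1, by decide⟩) vQ),
      ((sFull₀ p).D (wSetting p).n).Adm _ vQ A →
        ((sFull₀ p).D (wSetting p).n).Adm _ vQ (sFamDep p (cQ p) _ vQ '' A) ∧
          ((sFull₀ p).D (wSetting p).n).logvol _ vQ (sFamDep p (cQ p) _ vQ '' A) =
            ((sFull₀ p).D (wSetting p).n).logvol _ vQ A + c := by
  rintro ⟨c, hc⟩
  have h0 := (hc {0} (sData₀_adm_zero p _ vQ)).2
  rw [image_zero_eq] at h0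
  have hc0 : c = 0 := by linarith
  have h4 := (hc (sBall p ⊤ _ vQ 4) (sData₀_adm_sBall p _ vQ 4)).2
  rw [carry_sBall_four, hc0, add_zero] at h4
  have h4' : sVol p ⊤ _ vQ (sBall p ⊤ (Setting.labelSucc ⟨1, by decide⟩) vQ 1) =
      sVol p ⊤ _ vQ (sBall p ⊤ (Setting.labelSucc ⟨1, by decide⟩) vQ 4) := h4
  rw [sVol_sBall, sVol_sBall] at h4'
  have hl := log_p_pos p
  push_cast at h4'
  linarith

/-- **Log-volume monotonicity on admissible regions FAILS on the {0}-bed** (abc-iut-rp-j2's F1, here for the witness setting): `{0} ⊆ B_1` are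
both admissible at label `1` but `logvol {0} = 0 > −log p = logvol B_1`. So `BridgeHyps (wSetting p)` fails ALSO for this trivial reason — the
non-trivial content of `ObstructionSS6Witness.wSetting_price` is `negLogTheta = ⊤` / `¬ ThetaFinite`. [folklore] -/
theorem not_logvolMono_wSetting : ¬ LogvolMono (wSetting p) := by
  intro hmono
  have hl := log_p_pos p
  have h := hmono ⟨0, by decide⟩ () (sData₀_adm_zero p _ ()) (sData₀_adm_sBall p _ () 1)
    (by rintro x hx; rw [Set.mem_singleton_iff.1 hx]; exact zero_mem_sBall p ⊤ _ () 1)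
  have h' : sVol p ⊤ _ () ({0} : Set ((scalingShells p).Packet (Setting.labelSucc ⟨0, by decide⟩) ())) ≤
      sVol p ⊤ _ () (sBall p ⊤ (Setting.labelSucc ⟨0, by decide⟩) () 1) := h
  rw [sVol_zero, sVol_sBall] at h'
  push_cast at h'
  linarith

/-- The two reasons side by side: on the {0}-bed the witness setting has `¬ ThetaFinite` (the door-(b) price, monodromy) AND `¬ LogvolMono`
(the zero atom, junk) — both conjuncts of `BridgeHyps` fail, for unrelated reasons. [folklore] -/
theorem wSetting_bridgeHyps_fails_twice : ¬ (wSetting p).ThetaFinite ∧ ¬ LogvolMono (wSetting p) :=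
  ⟨(wSetting_price p).2.1, not_logvolMono_wSetting p⟩

end Summit.ABC.IUTFork.Repair.ObstructionSS31

end
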